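import Summits.QuantumFields.YangMills.Theorems.FradkinShenkerFlowStrongPinningPoincareModulo
import Literature.MathematicalPhysics.QuantumFieldTheory.PinnedOneLinkLaplaceProofs

/-!
# `StrongPinningPoincare` (route `FradkinShenkerFlow` of `YangMills`) — proved

Support item `stmt-QuantumFields-9446`: the heat-bath Poincaré inequality, with a constant uniform in
`β ≥ 0`, `s ≥ c(1+β)`, the torus and the background `X`, for the strongly pinned Wilson measures
`μ^{(s,X)} ∝ exp(s ∑_ℓ Re tr ρ(X_ℓ⁻¹ W_ℓ)) μ_{β,S}` with respect to their own one-link conditional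
laws (the Dobrushin end of the Fradkin–Shenker window).

The route decl was reduced in `FradkinShenkerFlowStrongPinningPoincareModulo` (and its imports:
tilted heat baths, the Kantorovich–Rubinstein form of Dobrushin's uniqueness ⇒ heat-bath Poincaré,
the perturbation lemma `abs_integral_tilted_add_sub_le`, the mixed Lipschitz bound of the Wilson
action) to the named fact
`Literature.MathematicalPhysics.QuantumFieldTheory.OneLinkLaplaceConcentration` — Laplace
concentration `Var ≤ K₁ Lip²/s` of the pinned one-link laws in the regime `s ≥ c₀(1+β)`. That fact
is now PROVED in the Literature (`PinnedOneLinkLaplaceProofs.OneLinkLaplaceConcentration_holds`: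
von Neumann's exponential chart of the compact matrix group `ρ(G)`, Morse bounds at the minimiser
from minimality and the inversion identity, volume doubling of Haar measure for Hilbert–Schmidt
balls, convexity in `s`), so the item closes unconditionally.
-/

namespace Summit.QuantumFields.YangMills.Theorems

/-- **`StrongPinningPoincare` holds**: the route decl
`Summit.QuantumFields.YangMills.Theses.FradkinShenkerFlow.StrongPinningPoincare`, from
`strongPinningPoincare_of_oneLinkLaplaceConcentration` and the proved Laplace concentration of
strongly pinned one-link laws `OneLinkLaplaceConcentration_holds`. [folklore] -/
theorem StrongPinningPoincare_proof :
    Summit.QuantumFields.YangMills.Theses.FradkinShenkerFlow.StrongPinningPoincare :=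
  StrongPinningPoincare.strongPinningPoincare_of_oneLinkLaplaceConcentration
    Literature.MathematicalPhysics.QuantumFieldTheory.OneLinkLaplaceConcentration_holds

end Summit.QuantumFields.YangMills.Theorems
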